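import Summits.HodgeConjecture.HodgeCM.PerL34.FockGroupInvariants_2

/-! PORT of `HodgeCM/PerL34/FockGroupInvariants.lean` (HodgeCMPerL run 81) — part 3: continuation of `Summits.HodgeConjecture.HodgeCM.PerL34.FockGroupInvariants_2` (split at a top-level declaration boundary by port_pkg.py; scope re-opened below; declarations unchanged). -/

-- port_pkg: scope re-opened for this part (file-level context, then the namespace/section stack open at the cut)
set_option autoImplicit false
open MvPolynomial Finsupp
open scoped BigOperators ComplexConjugate
namespace HodgeCM
namespace PerL34
namespace Fock
namespace GroupLevel
section Mixed
/-- The same rotation in the `(z₂,z₃)`-plane. -/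
noncomputable def R12 : Matrix (Fin 3) (Fin 3) ℂ := !![1, 0, 0; 0, 3/5, -4/5; 0, 4/5, 3/5]

/-- (Ported verbatim from the HodgeCMPerL package; no docstring in the source.) -/
theorem R01_mem : R01 ∈ Matrix.unitaryGroup (Fin 3) ℂ := by
  rw [Matrix.mem_unitaryGroup_iff]
  ext i j
  fin_cases i <;> fin_cases j <;>
    simp [R01, Matrix.mul_apply, Fin.sum_univ_three, Matrix.star_apply, Complex.conj_ofNat] <;> norm_num

/-- (Ported verbatim from the HodgeCMPerL package; no docstring in the source.) -/
theorem R12_mem : R12 ∈ Matrix.unitaryGroup (Fin 3) ℂ := by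
  rw [Matrix.mem_unitaryGroup_iff]
  ext i j
  fin_cases i <;> fin_cases j <;>
    simp [R12, Matrix.mul_apply, Fin.sum_univ_three, Matrix.star_apply, Complex.conj_ofNat] <;> norm_num

/-- (Ported verbatim from the HodgeCMPerL package; no docstring in the source.) -/
theorem R01_map_conj : R01.map (starRingEnd ℂ) = R01 := by
  ext i j
  fin_cases i <;> fin_cases j <;> simp [R01, Complex.conj_ofNat]

/-- (Ported verbatim from the HodgeCMPerL package; no docstring in the source.) -/
theorem R12_map_conj : R12.map (starRingEnd ℂ) = R12 := by
  ext i j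
  fin_cases i <;> fin_cases j <;> simp [R12, Complex.conj_ofNat]

/-- The point `z = (4,3,1)`, `w = (a/4, b/3, c)` (products `(a,b,c)`; `R01` sends it to a point with products
`(0, a+b, c)`). -/
noncomputable def pt01 (a b c : ℂ) : MixedVar → ℂ := Sum.elim ![4, 3, 1] ![a / 4, b / 3, c]

/-- The point `z = (1,4,3)`, `w = (a, b/4, c/3)` (products `(a,b,c)`; `R12` sends it to products `(a, 0, b+c)`). -/
noncomputable def pt12 (a b c : ℂ) : MixedVar → ℂ := Sum.elim ![1, 4, 3] ![a, b / 4, c / 3]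

/-! ### Main theorem -/

/-- PerL l. 502 at group level: a `U(3)`-invariant (`(A, Ā)`-fixed for all unitary `A`) polynomial lies in
`ℂ[P]`.  Proof: torus ⇒ `f = F(z₁w₁, z₂w₂, z₃w₃)`; the two rational rotations `R01, R12 ∈ SO(3)`, evaluated at the
points `pt01, pt12`, give `F(a,b,c) = F(0,a+b,c) = F(0,0,a+b+c)` for all `a b c : ℂ`; hence
`F = H(y₁+y₂+y₃)` (`MvPolynomial.funext`, `ℂ` infinite) and `f = H(P)`. -/
theorem IsU3InvariantGrp.mem_span {f : MixedModel} (h : IsU3InvariantGrp f) :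
    f ∈ Submodule.span ℂ (Set.range fun k : ℕ => P ^ k) := by
  classical
  -- (1) torus: balanced, so `f = diagSubst F`
  set F : MvPolynomial (Fin 3) ℂ := contract f with hFdef
  have hF : diagSubst F = f := diagSubst_contract fun m hm a => h.balanced hm a
  -- (2) the two rotations at the two families of points
  have h01 : ∀ a b c : ℂ, aeval ![0, a + b, c] F = aeval ![a, b, c] F := by
    intro a b c
    have h1 := congrArg (aeval (pt01 a b c)) (h R01 R01_mem)
    rw [R01_map_conj, ← hF, aeval_mixedSubst, aeval_diagSubst, aeval_diagSubst] at h1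
    have e1 : (fun i : Fin 3 =>
        Sum.elim (fun a' : Fin 3 => ∑ b', R01 a' b' * pt01 a b c (Sum.inl b'))
          (fun a' : Fin 3 => ∑ b', R01 a' b' * pt01 a b c (Sum.inr b')) (Sum.inl i) *
        Sum.elim (fun a' : Fin 3 => ∑ b', R01 a' b' * pt01 a b c (Sum.inl b'))
          (fun a' : Fin 3 => ∑ b', R01 a' b' * pt01 a b c (Sum.inr b')) (Sum.inr i)) = ![0, a + b, c] := by
      funext i
      fin_cases i <;> simp [pt01, R01, Fin.sum_univ_three, -mul_eq_zero] <;> ring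
    have e2 : (fun i : Fin 3 => pt01 a b c (Sum.inl i) * pt01 a b c (Sum.inr i)) = ![a, b, c] := by
      funext i
      fin_cases i <;> simp [pt01] <;> ring
    rw [e1, e2] at h1
    exact h1
  have h12 : ∀ a b c : ℂ, aeval ![a, 0, b + c] F = aeval ![a, b, c] F := by
    intro a b c
    have h1 := congrArg (aeval (pt12 a b c)) (h R12 R12_mem)
    rw [R12_map_conj, ← hF, aeval_mixedSubst, aeval_diagSubst, aeval_diagSubst] at h1
    have e1 : (fun i : Fin 3 =>
        Sum.elim (fun a' : Fin 3 => ∑ b', R12 a' b' * pt12 a b c (Sum.inl b'))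
          (fun a' : Fin 3 => ∑ b', R12 a' b' * pt12 a b c (Sum.inr b')) (Sum.inl i) *
        Sum.elim (fun a' : Fin 3 => ∑ b', R12 a' b' * pt12 a b c (Sum.inl b'))
          (fun a' : Fin 3 => ∑ b', R12 a' b' * pt12 a b c (Sum.inr b')) (Sum.inr i)) = ![a, 0, b + c] := by
      funext i
      fin_cases i <;> simp [pt12, R12, Fin.sum_univ_three, -mul_eq_zero] <;> ring
    have e2 : (fun i : Fin 3 => pt12 a b c (Sum.inl i) * pt12 a b c (Sum.inr i)) = ![a, b, c] := by
      funext i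
      fin_cases i <;> simp [pt12] <;> ring
    rw [e1, e2] at h1
    exact h1
  -- (3) `F = H(y₁ + y₂ + y₃)`
  set H : Polynomial ℂ := aeval (fun i : Fin 3 => if i = 2 then (Polynomial.X : Polynomial ℂ) else 0) F
    with hHdef
  have hH : ∀ s : ℂ, Polynomial.aeval s H = aeval ![0, 0, s] F := by
    intro s
    rw [hHdef, ← AlgHom.comp_apply, MvPolynomial.comp_aeval]
    have : (fun i : Fin 3 => (Polynomial.aeval s) (if i = 2 then (Polynomial.X : Polynomial ℂ) else 0))
        = ![0, 0, s] := by
      funext i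
      fin_cases i <;> simp
    rw [this]
  have hFH : F = Polynomial.aeval (X 0 + X 1 + X 2 : MvPolynomial (Fin 3) ℂ) H := by
    apply MvPolynomial.funext
    intro y
    change aeval y F = aeval y (Polynomial.aeval (X 0 + X 1 + X 2 : MvPolynomial (Fin 3) ℂ) H)
    rw [← Polynomial.aeval_algHom_apply, map_add, map_add, aeval_X, aeval_X, aeval_X, hH]
    have hy : y = ![y 0, y 1, y 2] := by
      funext i
      fin_cases i <;> rfl
    conv_lhs => rw [hy]
    rw [← h01, ← h12 0 (y 0 + y 1) (y 2)]
  -- (4) `f = H(P)`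
  rw [← hF, hFH, ← Polynomial.aeval_algHom_apply, diagSubst_P, Polynomial.aeval_eq_sum_range]
  exact Submodule.sum_mem _ fun k _ => Submodule.smul_mem _ _ (Submodule.subset_span ⟨k, rfl⟩)

/-- **(M) at group level — the `U(3)`-invariants of `ℂ[z,w]` are `ℂ[P]`** (PerL l. 502). -/
theorem isU3InvariantGrp_iff (f : MixedModel) :
    IsU3InvariantGrp f ↔ f ∈ Submodule.span ℂ (Set.range fun k : ℕ => P ^ k) :=
  ⟨IsU3InvariantGrp.mem_span, isU3InvariantGrp_of_mem_span⟩

/-- Group level ⟺ pv12's Lie-algebra level (`Fock.IsU3Invariant`: killed by the torus `𝔱` and the root operators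
`E_{ab}` of `𝔤𝔩₃ = 𝔲(3)_ℂ`; `Fock.isU3Invariant_iff`): the two typings of "`U(3)`-invariant" in `ℂ[z,w]` agree. -/
theorem isU3InvariantGrp_iff_isU3Invariant (f : MixedModel) : IsU3InvariantGrp f ↔ IsU3Invariant f := by
  rw [isU3InvariantGrp_iff, isU3Invariant_iff]

end Mixed

end GroupLevel
end Fock
end PerL34
end HodgeCM
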